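import Literature.Probability.LatticeModels.MeshDomainJordan
import Summits.CriticalPhenomena.SAWScalingLimit.Theorems.SAWLoopFugacityFlowAvoidanceLimitSegmentGeometry
import Mathlib.Topology.MetricSpace.Thickening
import Mathlib.Analysis.Normed.Module.Convex
import HarnessLib

/-!
# A walk of `Ω_δ` shadowing a continuum curve inside a Jordan domain
(line `symplectic-fermion-anchor`, crux `SAWLoopFugacityFlow.AvoidanceLimit`
`Summit.CriticalPhenomena.SAWScalingLimit.Theses.SAWLoopFugacityFlow.AvoidanceLimit`,
stmt-CriticalPhenomena-10649, stub W11 `exists_walk_near_curve`)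

For a Jordan domain `D`, a curve `γ : [0, 1] → D` and `ε > 0`, for all small mesh `δ > 0` there is
a walk of the discrete domain `Ω^δ = discreteDomainGraph D.carrier δ` from a site `ε`-close to
`γ 0` to a site `ε`-close to `γ 1`, all of whose sites are vertices of `Ω_δ = meshDomain D.carrier δ`
lying within `ε` of the trace of `γ`. This is the transversal ("a kept walk of `Ω^δ` along a
sub-arc of a gate") used in the hub construction of Chelkak's factorisation of the exit kernel of
the killed walk (Chelkak 2016, Remark 2.5 / Lemma 3.2), in the discretisation conventions of
Chelkak–Smirnov 2012, §1.2.

Proof. The trace `K = γ([0, 1])` is compact and some closed collar `cthickening ρ K` lies in `D`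
(`IsCompact.exists_cthickening_subset_open`). Put `η = min (ε/4) (ρ/2)` and
`K' = cthickening (2η) K ⊆ D`, compact. By uniform continuity subdivide `[0, 1]` at `tₖ = k/n`
with `|γ tₖ₊₁ - γ tₖ| < η`. For `δ < η/2` below the threshold of
`JordanDomain.exists_forall_mem_meshDomain_and_reachable` for `K'` (every site with mesh point in
`K'` is a vertex of `Ω_δ`), let `zₖ = nearestSite δ (γ tₖ)` (`|δ zₖ - γ tₖ| ≤ δ`) and join `zₖ` to
`zₖ₊₁` by the lattice staircase `exists_staircase_walk`, whose sites are within lattice distance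
`1` of the segment `[zₖ, zₖ₊₁]`; rescaled, they are within `δ + (δ + η) ≤ 2η < ε` of `γ tₖ`
(the mesh segment lies in the convex ball `B̄(γ tₖ, δ + η)`). Hence every staircase site has mesh
point in `K'`, so is a vertex of `Ω_δ`, and every staircase edge has its closed mesh segment in
the convex ball `B̄(γ tₖ, 2η) ⊆ K' ⊆ D ⊆ D̄`, so is an edge of `Ω^δ`. Concatenate.

## References
* D. Chelkak, *Robust discrete complex analysis: a toolbox*, Ann. Probab. 44 (2016),
  Remark 2.5, Lemma 3.2. [Chelkak2016]
* D. Chelkak, S. Smirnov, *Universality in the 2D Ising model and conformal invariance of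
  fermionic observables*, Invent. Math. 189 (2012), §1.2. [ChelkakSmirnov2012]
-/

noncomputable section

open Set Metric Filter Topology
open Literature.Probability.LatticeModels
open Literature.Probability.RandomPlanarGeometry (JordanDomain)

namespace Summit.CriticalPhenomena.SAWScalingLimit.Theorems.AvoidanceLimit.Anchor

/-- A walk of `G` all of whose `G`-edges between support vertices are also `H`-edges is traced by
a walk of `H` with the same support. [folklore] -/
private theorem exists_walk_support_eq_of_adj {V : Type*} {G H : SimpleGraph V} :
    ∀ {u v : V} (p : G.Walk u v),
      (∀ x ∈ p.support, ∀ y ∈ p.support, G.Adj x y → H.Adj x y) →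
      ∃ q : H.Walk u v, q.support = p.support
  | _, _, .nil, _ => ⟨.nil, rfl⟩
  | _, _, .cons h p, hH => by
    obtain ⟨q, hq⟩ := exists_walk_support_eq_of_adj (H := H) p
      (fun x hx y hy => hH x (by simp [hx]) y (by simp [hy]))
    exact ⟨.cons (hH _ (by simp) _ (by simp) h) q, by simp [hq]⟩

/-- Concatenation of a chain of walks `f 0 ⇝ f 1 ⇝ ⋯ ⇝ f n` whose supports satisfy a property `Q`
gives a walk `f 0 ⇝ f n` whose support satisfies `Q`. [folklore] -/
private theorem exists_walk_concat_of_forall {V : Type*} {G : SimpleGraph V} (f : ℕ → V)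
    (Q : V → Prop) (h0 : Q (f 0)) :
    ∀ n : ℕ, (∀ k < n, ∃ w : G.Walk (f k) (f (k + 1)), ∀ v ∈ w.support, Q v) →
      ∃ w : G.Walk (f 0) (f n), ∀ v ∈ w.support, Q v
  | 0, _ => ⟨.nil, by simpa using h0⟩
  | n + 1, h => by
    obtain ⟨w, hw⟩ := exists_walk_concat_of_forall f Q h0 n (fun k hk => h k (by omega))
    obtain ⟨w', hw'⟩ := h n (by omega)
    refine ⟨w.append w', fun v hv => ?_⟩
    rw [SimpleGraph.Walk.mem_support_append_iff] at hv
    exact hv.elim (hw v) (hw' v)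

/-- **A walk of `Ω^δ` shadowing a curve in the domain.** For a Jordan domain `D`, a curve
`γ : [0, 1] → D.carrier` (continuous on `[0, 1]`) and `ε > 0`, for all sufficiently small mesh
`δ > 0` there are sites `u`, `v` with `|δu - γ 0| < ε`, `|δv - γ 1| < ε` and a walk of
`discreteDomainGraph D.carrier δ` from `u` to `v` all of whose sites lie in
`meshDomain D.carrier δ` and within `ε` of some point `γ t`, `t ∈ [0, 1]` (lattice staircases
between the nearest sites of a fine subdivision of the curve; see the module docstring).
[cite: Chelkak2016, Remark 2.5] -/
theorem exists_walk_near_curve :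
    ∀ (D : JordanDomain) (γ : ℝ → ℂ), ContinuousOn γ (Set.Icc 0 1) → (∀ t ∈ Set.Icc (0 : ℝ) 1, γ t ∈ D.carrier) →
      ∀ ε : ℝ, 0 < ε → ∀ᶠ δ in 𝓝[>] (0 : ℝ),
        ∃ (u v : Site 2) (w : (discreteDomainGraph D.carrier δ).Walk u v),
          dist (meshPoint δ u) (γ 0) < ε ∧ dist (meshPoint δ v) (γ 1) < ε ∧
          ∀ z ∈ w.support, z ∈ meshDomain D.carrier δ ∧ ∃ t ∈ Set.Icc (0 : ℝ) 1, dist (meshPoint δ z) (γ t) < ε := by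
  intro D γ hγ hγD ε hε
  -- the compact trace of the curve and a closed collar of it inside the domain
  set K : Set ℂ := γ '' Icc 0 1 with hK_def
  have hK : IsCompact K := isCompact_Icc.image_of_continuousOn hγ
  have hKD : K ⊆ D.carrier := by
    rintro _ ⟨s, hs, rfl⟩
    exact hγD s hs
  obtain ⟨ρ, hρ, hρD⟩ := hK.exists_cthickening_subset_open D.isOpen hKD
  -- the working radius `η` and the compact collar `K'`
  obtain ⟨η, hη, hηε, hηρ⟩ : ∃ η : ℝ, 0 < η ∧ 4 * η ≤ ε ∧ 2 * η ≤ ρ :=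
    ⟨min (ε / 4) (ρ / 2), lt_min (by linarith) (by linarith),
      by linarith [min_le_left (ε / 4) (ρ / 2)], by linarith [min_le_right (ε / 4) (ρ / 2)]⟩
  set K' : Set ℂ := cthickening (2 * η) K with hK'_def
  have hK' : IsCompact K' := hK.cthickening
  have hK'D : K' ⊆ D.carrier := (cthickening_mono hηρ K).trans hρD
  -- uniform continuity: a subdivision `tₖ = k / n` of `[0, 1]` with `|γ tₖ₊₁ - γ tₖ| < η`
  obtain ⟨θ, hθ, hθγ⟩ := Metric.uniformContinuousOn_iff.1
    (isCompact_Icc.uniformContinuousOn_of_continuous hγ) η hη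
  obtain ⟨n, hn⟩ := exists_nat_gt (1 / θ)
  have hn0 : (0 : ℝ) < n := lt_trans (by positivity) hn
  have hnθ : 1 / (n : ℝ) < θ := by
    rw [div_lt_iff₀ hn0]
    exact (div_lt_iff₀' hθ).1 hn
  obtain ⟨t, ht_def⟩ : ∃ t : ℕ → ℝ, t = fun k : ℕ => (k : ℝ) / n := ⟨_, rfl⟩
  have ht_mem : ∀ k ≤ n, t k ∈ Icc (0 : ℝ) 1 := fun k hk => by
    rw [ht_def]
    exact ⟨div_nonneg k.cast_nonneg hn0.le, (div_le_one hn0).2 (by exact_mod_cast hk)⟩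
  have ht0 : t 0 = 0 := by simp [ht_def]
  have htn : t n = 1 := by simp [ht_def, div_self hn0.ne']
  have hγstep : ∀ k < n, dist (γ (t (k + 1))) (γ (t k)) < η := by
    intro k hk
    refine hθγ _ (ht_mem _ hk) _ (ht_mem _ hk.le) ?_
    have : t (k + 1) - t k = 1 / n := by
      simp only [ht_def]
      push_cast
      ring
    rw [Real.dist_eq, this, abs_of_pos (by positivity)]
    exact hnθ
  -- eventually in `δ`: the lattice points of `K'` are vertices of `Ω_δ`, and `δ < η / 2`
  filter_upwards [D.eventually_forall_mem_meshDomain' hK' hK'D, Ioo_mem_nhdsGT (half_pos hη)]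
    with δ hdom hδ
  obtain ⟨hδ0, hδη⟩ := hδ
  replace hdom := hdom.1
  -- the sites nearest to the subdivision points
  obtain ⟨z, hz_def⟩ : ∃ z : ℕ → Site 2, z = fun k => nearestSite δ (γ (t k)) := ⟨_, rfl⟩
  have hz : ∀ k, dist (meshPoint δ (z k)) (γ (t k)) ≤ δ := fun k => by
    rw [hz_def]
    exact dist_meshPoint_nearestSite_le hδ0 _
  -- the target property of the sites of the walk
  set Q : Site 2 → Prop := fun x => x ∈ meshDomain D.carrier δ ∧
    ∃ s ∈ Icc (0 : ℝ) 1, dist (meshPoint δ x) (γ s) < ε with hQ_def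
  -- sites within `2η` of a subdivision point are vertices of `Ω_δ` …
  have hnear_dom : ∀ k ≤ n, ∀ x : Site 2, dist (meshPoint δ x) (γ (t k)) ≤ 2 * η →
      x ∈ meshDomain D.carrier δ := fun k hk x hx =>
    hdom x (mem_cthickening_of_dist_le _ _ _ _ (mem_image_of_mem γ (ht_mem k hk)) hx)
  have hnear_Q : ∀ k ≤ n, ∀ x : Site 2, dist (meshPoint δ x) (γ (t k)) ≤ 2 * η → Q x :=
    fun k hk x hx => ⟨hnear_dom k hk x hx, t k, ht_mem k hk, by linarith⟩
  -- … and lattice edges between two such sites are edges of `Ω^δ`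
  have hnear_adj : ∀ k ≤ n, ∀ x y : Site 2, dist (meshPoint δ x) (γ (t k)) ≤ 2 * η →
      dist (meshPoint δ y) (γ (t k)) ≤ 2 * η → (zdGraph 2).Adj x y →
      (discreteDomainGraph D.carrier δ).Adj x y := by
    intro k hk x y hx hy hxy
    rw [discreteDomainGraph_adj_iff, meshGraph_adj_iff]
    refine ⟨⟨hxy, ?_⟩, hnear_dom k hk x hx, hnear_dom k hk y hy⟩
    have hball : closedBall (γ (t k)) (2 * η) ⊆ closure D.carrier :=
      (((closedBall_subset_cthickening (mem_image_of_mem γ (ht_mem k hk)) (2 * η)).trans hK'D).trans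
        subset_closure)
    exact ((convex_closedBall _ _).segment_subset (mem_closedBall.2 hx)
      (mem_closedBall.2 hy)).trans hball
  -- the staircase from `z k` to `z (k + 1)` stays within `2δ + η ≤ 2η` of `γ (t k)`
  have hstair : ∀ k < n, ∃ w : (discreteDomainGraph D.carrier δ).Walk (z k) (z (k + 1)),
      ∀ x ∈ w.support, Q x := by
    intro k hk
    obtain ⟨π, -, hπ⟩ := exists_staircase_walk (z k) (z (k + 1))
    have hclose : ∀ x ∈ π.support, dist (meshPoint δ x) (γ (t k)) ≤ 2 * η := by
      intro x hx
      obtain ⟨s, hs, hsx⟩ := hπ x hx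
      -- the comparison point on the mesh segment `[δ z k, δ z (k + 1)]`
      have h1 : dist (meshPoint δ x) (meshPoint δ (z k) +
          s * (meshPoint δ (z (k + 1)) - meshPoint δ (z k))) ≤ δ := by
        have : meshPoint δ (z k) + (s : ℂ) * (meshPoint δ (z (k + 1)) - meshPoint δ (z k)) =
            (δ : ℂ) * (Site.toComplex (z k) +
              s * (Site.toComplex (z (k + 1)) - Site.toComplex (z k))) := by
          simp only [meshPoint]
          ring
        rw [this, meshPoint, dist_eq_norm, ← mul_sub, norm_mul, Complex.norm_real,
          Real.norm_eq_abs, abs_of_pos hδ0, ← dist_eq_norm]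
        have := mul_le_mul_of_nonneg_left hsx hδ0.le
        linarith
      have h2 : dist (meshPoint δ (z k) + s * (meshPoint δ (z (k + 1)) - meshPoint δ (z k)))
          (γ (t k)) ≤ δ + η := by
        have hP : meshPoint δ (z k) ∈ closedBall (γ (t k)) (δ + η) := by
          rw [mem_closedBall]
          exact (hz k).trans (by linarith)
        have hP' : meshPoint δ (z (k + 1)) ∈ closedBall (γ (t k)) (δ + η) := by
          rw [mem_closedBall]
          calc dist (meshPoint δ (z (k + 1))) (γ (t k))
              ≤ dist (meshPoint δ (z (k + 1))) (γ (t (k + 1))) + dist (γ (t (k + 1))) (γ (t k)) :=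
                dist_triangle _ _ _
            _ ≤ δ + η := add_le_add (hz (k + 1)) (hγstep k hk).le
        have hmem : meshPoint δ (z k) + (s : ℂ) * (meshPoint δ (z (k + 1)) - meshPoint δ (z k)) ∈
            segment ℝ (meshPoint δ (z k)) (meshPoint δ (z (k + 1))) := by
          rw [segment_eq_image' ℝ]
          exact ⟨s, hs, by simp only [Complex.real_smul]⟩
        exact mem_closedBall.1 ((convex_closedBall _ _).segment_subset hP hP' hmem)
      calc dist (meshPoint δ x) (γ (t k))
          ≤ dist (meshPoint δ x) (meshPoint δ (z k) +
              s * (meshPoint δ (z (k + 1)) - meshPoint δ (z k))) +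
            dist (meshPoint δ (z k) + s * (meshPoint δ (z (k + 1)) - meshPoint δ (z k)))
              (γ (t k)) := dist_triangle _ _ _
        _ ≤ δ + (δ + η) := add_le_add h1 h2
        _ ≤ 2 * η := by linarith
    obtain ⟨w, hw⟩ := exists_walk_support_eq_of_adj (H := discreteDomainGraph D.carrier δ) π
      (fun x hx y hy hxy => hnear_adj k hk.le x y (hclose x hx) (hclose y hy) hxy)
    exact ⟨w, fun x hx => hnear_Q k hk.le x (hclose x (hw ▸ hx))⟩
  -- concatenate the staircases
  obtain ⟨w, hw⟩ := exists_walk_concat_of_forall (G := discreteDomainGraph D.carrier δ) z Q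
    (hnear_Q 0 (Nat.zero_le n) (z 0) ((hz 0).trans (by linarith))) n hstair
  refine ⟨z 0, z n, w, ?_, ?_, hw⟩
  · calc dist (meshPoint δ (z 0)) (γ 0) = dist (meshPoint δ (z 0)) (γ (t 0)) := by rw [ht0]
      _ ≤ δ := hz 0
      _ < ε := by linarith
  · calc dist (meshPoint δ (z n)) (γ 1) = dist (meshPoint δ (z n)) (γ (t n)) := by rw [htn]
      _ ≤ δ := hz n
      _ < ε := by linarith

end Summit.CriticalPhenomena.SAWScalingLimit.Theorems.AvoidanceLimit.Anchor

end
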